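import Mathlib
import HarnessLib
import Literature.NumberTheory.DiophantineGeometry.RothPrelim
import Literature.NumberTheory.DiophantineGeometry.RothTaylor

/-!
# Roth's theorem after Schmidt (LNM 785, Ch. V) — Roth's Lemma 10A: completion of the inductive step

Source: W. M. Schmidt, *Diophantine Approximation*, LNM 785 (1980), Ch. V §10, "Completion of the
proof of Theorem 10A" (book pp. 132–133) together with the last lines of the proof of Lemma 10B
(p. 132) [Schmidt1980].

This file proves the **top half** of the inductive step `m - 1 ⇒ m` of Roth's Lemma, as an
unconditional theorem about an abstract "Wronskian package" (`Roth.rothLemma_of_wronskianData`):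
let `P ∈ ℤ[X₀,…,X_n,X_{n+1}]` (`m = n + 2 ≥ 2` variables, the last one playing Schmidt's `X_m`),
weights `r` with `r_{h+1} ≤ ω r_h` ((10.3), `ω = ω(m, ε)`, `0 < ε < 1/12`), a point `a`, an
integer `1 ≤ k ≤ r_m + 1`, operators `Δ'_i = ∂_{μ_i}` not involving `X_m` with `|μ_i| ≤ i`
((10.9)), the generalized Wronskian `W = det (P_{μ_i, j})_{i,j<k}` and a factorisation
`W = V · U` with `V` free of `X_m` and `U` a polynomial in `X_m` alone; if `V` has index
`≤ kε²/12` and `U` has index `≤ kε²/12` at `a` (the conclusions of Roth's Lemma applied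
inductively to `V*`, `U*`, last display of the proof of Lemma 10B), then `P` has index `≤ ε` at
`a` with respect to `r` — in the tree's witness form `∃ i, Σ i_h/r_h ≤ ε ∧ P_i(a) ≠ 0`.

Ingredients, all as printed: the index of `W` is `≤ kε²/6` (a product in disjoint variables,
`Roth.aeval_hasseD_mul_of_disjoint`); by Lemma 6A the index of `W` is
`≥ Σ_{j<k} max(θ - ω - j/r_m, 0)` for any lower bound `θ` of the index of `P`
(`Roth.indexGe_det_of_columns`, (10.9), (10.3)); `ω ≤ ε²/24` ((10.2), `m ≥ 2`); and the
elementary Cases I/II of p. 133: `Σ_{j<k} max(θ - j/r_m, 0) < kε²/4`, `k ≤ r_m + 1` force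
`θ < ε` (`Roth.lt_of_sum_max_sub_lt`). Lower bounds `θ` of the index slightly above `ε` exist as
soon as all `P_i(a)` with `Σ i_h/r_h ≤ ε` vanish (`Roth.exists_indexGe_gt`, finiteness of the box
of multi-indices), which gives the contradiction.

The bottom half of the step (minimal decomposition `P = Σ φ_j(X') ψ_j(X_m)`, Lemma 9A, the
integral splitting `W = V* U*`, the height estimate (10.10) and the inductive application of 10A)
produces exactly such a package; the case `m = 1` is `Roth.rothLemma_oneVar` (`RothLemmaOne`).

## References

* [Schmidt1980] W. M. Schmidt, *Diophantine Approximation*, LNM 785, Springer 1980, Ch. V §10,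
  Theorem 10A, Lemma 10B, pp. 129–133.
-/

noncomputable section

open MvPolynomial Finset

namespace Literature.NumberTheory.DiophantineGeometry

namespace Roth

/-! ### Cases I and II (Schmidt, p. 133) -/

/-- **Schmidt's Cases I/II** (end of the proof of Theorem 10A): if `1 ≤ k ≤ r + 1`, `0 < ε < 2`,
`θ ≥ 0` and `Σ_{j<k} max(θ - j/r, 0) < kε²/4` (10.11), then `θ < ε`. (Case I, `θ > (k-1)/r`:
the sum is `≥ kθ/2`, so `θ < ε²/2 < ε`; Case II: the first `⌊θr⌋ + 1 ≤ k` terms already give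
`≥ θ²r/2`, and `k ≤ 2r`.) [cite: Schmidt1980, Ch. V Thm 10A (p. 133, Cases I, II)] -/
theorem lt_of_sum_max_sub_lt {k r : ℕ} (hk : 0 < k) (hkr : k ≤ r + 1) (hr : 0 < r) {ε θ : ℝ}
    (hε : 0 < ε) (hε2 : ε < 2) (hθ : 0 ≤ θ)
    (hsum : ∑ j ∈ Finset.range k, max (θ - j / r) 0 < k * ε ^ 2 / 4) : θ < ε := by
  have hrR : (0 : ℝ) < r := by exact_mod_cast hr
  have hkR : (0 : ℝ) < k := by exact_mod_cast hk
  by_cases hcase : ((k : ℝ) - 1) / r < θ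
  · -- Case I: all terms are positive
    have h1 : ∑ j ∈ Finset.range k, max (θ - j / r) 0 = ∑ j ∈ Finset.range k, (θ - j / r) := by
      apply Finset.sum_congr rfl
      intro j hj
      rw [Finset.mem_range] at hj
      apply max_eq_left
      have : (j : ℝ) / r ≤ ((k : ℝ) - 1) / r := by
        apply div_le_div_of_nonneg_right _ hrR.le
        have : (j : ℝ) + 1 ≤ k := by exact_mod_cast hj
        linarith
      linarith
    have h2 : ∑ j ∈ Finset.range k, ((θ : ℝ) - j / r) = k * θ - (∑ j ∈ Finset.range k, (j : ℝ)) / r := by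
      rw [Finset.sum_sub_distrib, Finset.sum_const, Finset.card_range, nsmul_eq_mul, Finset.sum_div]
    have h3 : (∑ j ∈ Finset.range k, (j : ℝ)) = k * ((k : ℝ) - 1) / 2 := by
      have := Finset.sum_range_id_mul_two k
      have h' : ((∑ j ∈ Finset.range k, j : ℕ) : ℝ) * 2 = (k : ℝ) * ((k : ℝ) - 1) := by
        have hk1 : ((k - 1 : ℕ) : ℝ) = (k : ℝ) - 1 := by
          rw [Nat.cast_sub (by omega)]; simp
        rw [← hk1]; exact_mod_cast this
      push_cast at h'
      linarith
    rw [h1, h2, h3] at hsum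
    -- `kθ - k(k-1)/(2r) = (k/2)(θ + (θ - (k-1)/r)) ≥ kθ/2`
    have h4 : (k : ℝ) * θ / 2 < k * ε ^ 2 / 4 := by
      have h5 : (k : ℝ) * ((k : ℝ) - 1) / 2 / r = k / 2 * (((k : ℝ) - 1) / r) := by ring
      rw [h5] at hsum
      nlinarith [hcase, hkR]
    have h6 : θ < ε ^ 2 / 2 := by nlinarith
    nlinarith
  · -- Case II: the first `⌊θ r⌋ + 1` terms
    push Not at hcase
    set N : ℕ := ⌊θ * r⌋₊ with hN
    have hNle : (N : ℝ) ≤ θ * r := Nat.floor_le (by positivity)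
    have hNlt : θ * r < N + 1 := Nat.lt_floor_add_one _
    have hNk : N + 1 ≤ k := by
      have : θ * r ≤ (k : ℝ) - 1 := (le_div_iff₀ hrR).mp hcase
      have : (N : ℝ) ≤ (k : ℝ) - 1 := hNle.trans this
      have : (N : ℝ) + 1 ≤ k := by linarith
      exact_mod_cast this
    have h1 : ∑ j ∈ Finset.range (N + 1), (θ - j / r) ≤ ∑ j ∈ Finset.range k, max (θ - j / r) 0 := by
      calc ∑ j ∈ Finset.range (N + 1), (θ - j / r) ≤ ∑ j ∈ Finset.range (N + 1), max (θ - j / r) 0 :=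
            Finset.sum_le_sum fun j _ => le_max_left _ _
        _ ≤ ∑ j ∈ Finset.range k, max (θ - j / r) 0 :=
            Finset.sum_le_sum_of_subset_of_nonneg (Finset.range_subset_range.mpr hNk)
              (fun j _ _ => le_max_right _ _)
    have h2 : ∑ j ∈ Finset.range (N + 1), (θ - (j : ℝ) / r) =
        (N + 1) * θ - (∑ j ∈ Finset.range (N + 1), (j : ℝ)) / r := by
      rw [Finset.sum_sub_distrib, Finset.sum_const, Finset.card_range, nsmul_eq_mul, Finset.sum_div]
      push_cast; ring
    have h3 : (∑ j ∈ Finset.range (N + 1), (j : ℝ)) = (N + 1) * (N : ℝ) / 2 := by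
      have := Finset.sum_range_id_mul_two (N + 1)
      simp only [Nat.add_sub_cancel] at this
      have h' : ((∑ j ∈ Finset.range (N + 1), j : ℕ) : ℝ) * 2 = ((N : ℝ) + 1) * N := by
        exact_mod_cast this
      push_cast at h'
      linarith
    rw [h2, h3] at h1
    -- `(N+1)(θ - N/(2r)) ≥ (N+1) θ/2 ≥ θ² r/2`
    have h4 : ((N : ℝ) + 1) * θ / 2 ≤ ((N : ℝ) + 1) * θ - ((N : ℝ) + 1) * N / 2 / r := by
      have : (N : ℝ) / r ≤ θ := by rw [div_le_iff₀ hrR]; exact hNle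
      have h' : ((N : ℝ) + 1) * N / 2 / r = ((N : ℝ) + 1) / 2 * (N / r) := by ring
      rw [h']
      nlinarith
    have h5 : θ ^ 2 * r / 2 ≤ ((N : ℝ) + 1) * θ / 2 := by nlinarith
    have h6 : θ ^ 2 * r / 2 < k * ε ^ 2 / 4 := by linarith
    have h7 : (k : ℝ) ≤ 2 * r := by
      have : (k : ℝ) ≤ r + 1 := by exact_mod_cast hkr
      have : (1 : ℝ) ≤ r := by exact_mod_cast hr
      linarith
    have h8 : θ ^ 2 < ε ^ 2 := by nlinarith
    nlinarith

/-! ### The constant `ω` for `m ≥ 2` -/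

/-- `ω(m, ε) ≤ ε²/24` for `m ≥ 2`, `0 ≤ ε ≤ 12` (from (10.2); used as `ω ≤ ε²/24` on p. 132).
[cite: Schmidt1980, Ch. V Thm 10A (p. 132, "by (10.2), since m ≥ 2")] -/
theorem omega_le_sq_div (m : ℕ) (hm : 2 ≤ m) {ε : ℝ} (hε0 : 0 ≤ ε) (hε : ε ≤ 12) :
    omega m ε ≤ ε ^ 2 / 24 := by
  unfold omega
  have h1 : (24 : ℝ) * 2⁻¹ ^ m ≤ 6 := by
    have : (2⁻¹ : ℝ) ^ m ≤ 2⁻¹ ^ 2 := pow_le_pow_of_le_one (by norm_num) (by norm_num) hm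
    norm_num at this ⊢
    linarith
  have h2 : (ε / 12) ^ 2 ^ (m - 1) ≤ (ε / 12) ^ 2 := by
    apply pow_le_pow_of_le_one (by positivity) (by linarith)
    calc 2 = 2 ^ 1 := by norm_num
      _ ≤ 2 ^ (m - 1) := Nat.pow_le_pow_right two_pos (by omega)
  calc 24 * 2⁻¹ ^ m * (ε / 12) ^ 2 ^ (m - 1) ≤ 6 * (ε / 12) ^ 2 :=
        mul_le_mul h1 h2 (by positivity) (by norm_num)
    _ = ε ^ 2 / 24 := by ring

/-! ### Lower bounds of the index just above `ε` -/

/-- If every `P_i(a)` with `Σ i_h/r_h ≤ t` vanishes then the index of `P` at `a` exceeds `t`: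
there is `t' > t` with `Ind P ≥ t'` (the weights of the finitely many `i` with `P_i ≠ 0` form a
finite set). [cite: Schmidt1980, Ch. V §6 Definition] -/
theorem exists_indexGe_gt {σ : Type*} [Fintype σ] [DecidableEq σ] {S A : Type*} [CommRing S]
    [CommRing A] [Algebra S A] (P : MvPolynomial σ S) (a : σ → A) (r : σ → ℕ) (t : ℝ)
    (h : ∀ i : σ →₀ ℕ, wt r i ≤ t → aeval a (hasseD i P) = 0) :
    ∃ t' : ℝ, t < t' ∧ IndexGe P a r t' := by
  classical
  -- the box containing all `i` with `P_i ≠ 0`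
  set B : Finset (σ →₀ ℕ) := Finset.Iic (Finsupp.equivFunOnFinite.symm fun h => P.degreeOf h)
    with hB
  have hbox : ∀ i, hasseD i P ≠ 0 → i ∈ B := fun i hi =>
    mem_Iic_of_hasseD_ne_zero (fun h => P.degreeOf h) (fun h => le_rfl) hi
  set Wt : Finset ℝ := (B.filter fun i => t < wt r i).image fun i => wt r i with hWt
  by_cases hne : Wt.Nonempty
  · refine ⟨Wt.min' hne, ?_, ?_⟩
    · have := Finset.min'_mem Wt hne
      obtain ⟨i, hi, hiw⟩ := Finset.mem_image.mp this
      rw [Finset.mem_filter] at hi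
      rw [← hiw]; exact hi.2
    · intro i hi
      by_cases hit : wt r i ≤ t
      · exact h i hit
      · push Not at hit
        by_cases hiB : i ∈ B
        · exfalso
          have hmem : wt r i ∈ Wt := by
            rw [hWt, Finset.mem_image]; exact ⟨i, Finset.mem_filter.mpr ⟨hiB, hit⟩, rfl⟩
          have := Finset.min'_le Wt _ hmem
          linarith
        · have : hasseD i P = 0 := by
            by_contra hne'; exact hiB (hbox i hne')
          rw [this, map_zero]
  · refine ⟨t + 1, by linarith, ?_⟩
    intro i _
    by_cases hit : wt r i ≤ t
    · exact h i hit
    · push Not at hit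
      by_cases hiB : i ∈ B
      · exfalso; apply hne
        exact ⟨wt r i, by rw [hWt, Finset.mem_image]; exact ⟨i, Finset.mem_filter.mpr ⟨hiB, hit⟩, rfl⟩⟩
      · have : hasseD i P = 0 := by
          by_contra hne'; exact hiB (hbox i hne')
        rw [this, map_zero]

/-! ### Products in disjoint sets of variables -/

section Disjoint

variable {σ : Type*} [Fintype σ] [DecidableEq σ] {S A : Type*} [CommRing S] [CommRing A]
  [Algebra S A]

omit [Fintype σ] [DecidableEq σ] in
/-- If `V` does not involve `X_{t₀}`, then `V_i = 0` unless `i_{t₀} = 0`. [folklore] -/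
theorem hasseD_eq_zero_of_degreeOf_eq_zero {V : MvPolynomial σ S} {t₀ : σ}
    (hV : V.degreeOf t₀ = 0) {i : σ →₀ ℕ} (hi : i t₀ ≠ 0) : hasseD i V = 0 :=
  hasseD_eq_zero_of_degreeOf_lt (h := t₀) (by rw [hV]; omega)

/-- If `U` involves only `X_{t₀}`, then `U_i = 0` unless `i` is a multiple of `e_{t₀}`.
[folklore] -/
theorem hasseD_eq_zero_of_forall_degreeOf_eq_zero {U : MvPolynomial σ S} {t₀ : σ}
    (hU : ∀ h, h ≠ t₀ → U.degreeOf h = 0) {i : σ →₀ ℕ} (hi : i ≠ Finsupp.single t₀ (i t₀)) :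
    hasseD i U = 0 := by
  have : ∃ h, h ≠ t₀ ∧ i h ≠ 0 := by
    by_contra hcon
    push Not at hcon
    apply hi
    ext h
    rw [Finsupp.single_apply]
    split_ifs with h1
    · rw [h1]
    · exact hcon h (Ne.symm h1)
  obtain ⟨h, hh, hih⟩ := this
  exact hasseD_eq_zero_of_degreeOf_lt (h := h) (by rw [hU h hh]; omega)

/-- **Derivatives of a product in disjoint variables**: if `V` is free of `X_{t₀}`, `U` involves
only `X_{t₀}` and `i_{t₀} = 0`, then `(VU)_{i + ν e_{t₀}}(a) = V_i(a) · U_{ν e_{t₀}}(a)` (the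
Leibniz sum (6.1) has a single non-zero term). [cite: Schmidt1980, Ch. V proof of Lemma 10B
(last paragraph, "Since W = U*V*")] -/
theorem aeval_hasseD_mul_of_disjoint {V U : MvPolynomial σ S} {t₀ : σ} (hV : V.degreeOf t₀ = 0)
    (hU : ∀ h, h ≠ t₀ → U.degreeOf h = 0) (a : σ → A) {i : σ →₀ ℕ} (hi : i t₀ = 0) (ν : ℕ) :
    aeval a (hasseD (i + Finsupp.single t₀ ν) (V * U)) =
      aeval a (hasseD i V) * aeval a (hasseD (Finsupp.single t₀ ν) U) := by
  classical
  rw [aeval_hasseD_mul]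
  rw [Finset.sum_eq_single (i, Finsupp.single t₀ ν)]
  · rintro ⟨x1, x2⟩ hx hne
    rw [Finset.HasAntidiagonal.mem_antidiagonal] at hx
    simp only at hx ⊢
    -- either `x1` involves `t₀`, or `x2` is not a multiple of `e_{t₀}`, or `(x1, x2) = (i, ν e)`
    by_cases h1 : x1 t₀ ≠ 0
    · rw [hasseD_eq_zero_of_degreeOf_eq_zero hV h1, map_zero, zero_mul]
    · push Not at h1
      by_cases h2 : x2 = Finsupp.single t₀ (x2 t₀)
      · exfalso
        apply hne
        have hx2 : x2 t₀ = ν := by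
          have := DFunLike.congr_fun hx t₀
          simp only [Finsupp.coe_add, Pi.add_apply, Finsupp.single_eq_same, h1, hi] at this
          omega
        have hx1 : x1 = i := by
          ext h
          have := DFunLike.congr_fun hx h
          simp only [Finsupp.coe_add, Pi.add_apply, Finsupp.single_apply] at this
          by_cases hh : t₀ = h
          · subst hh; rw [h1, hi]
          · rw [if_neg hh] at this
            have hx2h : x2 h = 0 := by
              rw [h2, Finsupp.single_apply, if_neg hh]
            omega
        rw [hx1, h2, hx2]
      · rw [hasseD_eq_zero_of_forall_degreeOf_eq_zero hU h2, map_zero, mul_zero]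
  · intro hnot
    exfalso
    exact hnot (Finset.HasAntidiagonal.mem_antidiagonal.mpr rfl)

end Disjoint

/-! ### Lemma 6A for determinants (the index of the generalized Wronskian) -/

section Det

variable {σ : Type*} [Fintype σ] [DecidableEq σ] {S A : Type*} [CommRing S] [CommRing A]
  [Algebra S A]

omit [DecidableEq σ] in
/-- **The index of a determinant** (Lemma 6A (ii), (iii) applied to the Leibniz expansion, as on
p. 132): if every entry of column `j` has index `≥ c_j`, then `det M` has index
`≥ Σ_j max(c_j, 0)`. [cite: Schmidt1980, Ch. V Thm 10A (p. 132, "Since W is a sum of products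
of k elements, one from each column")] -/
theorem indexGe_det_of_columns {k : ℕ} (M : Matrix (Fin k) (Fin k) (MvPolynomial σ S))
    (a : σ → A) (r : σ → ℕ) (c : Fin k → ℝ) (hM : ∀ i j, IndexGe (M i j) a r (c j)) :
    IndexGe M.det a r (∑ j, max (c j) 0) := by
  rw [Matrix.det_apply]
  apply IndexGe.sum
  intro τ _
  have hprod : IndexGe (∏ i, M (τ i) i) a r (∑ j, max (c j) 0) := by
    have := IndexGe.prod (Finset.univ : Finset (Fin k)) (f := fun i => M (τ i) i) (a := a) (r := r)
      (t := fun j => max (c j) 0) (fun i _ => ?_)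
    · exact this
    · by_cases hc : c i ≤ 0
      · rw [max_eq_right hc]; exact indexGe_of_nonpos _ _ _ le_rfl
      · rw [max_eq_left (le_of_lt (not_le.mp hc))]; exact hM _ _
  rcases Int.units_eq_one_or (Equiv.Perm.sign τ) with h | h
  · rw [h, one_smul]; exact hprod
  · rw [h, Units.neg_smul, one_smul]; exact hprod.neg

end Det

/-! ### The top half of the inductive step of Roth's Lemma -/

/-- From (10.3) `r_{h+1} ≤ ω r_h` with `ω ≤ 1`: the weights decrease, `r_{h'} ≤ r_h` for `h ≤ h'`.
[cite: Schmidt1980, Ch. V Thm 10A (p. 131, "since r₁ ≥ r₂ ≥ ⋯ ≥ r_m by (10.2) and (10.3)")] -/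
theorem antitone_of_succ_le {m : ℕ} {ω : ℝ} (hω : ω ≤ 1) (r : Fin m → ℕ)
    (hr : ∀ h h' : Fin m, (h : ℕ) + 1 = h' → (r h' : ℝ) ≤ ω * r h) :
    ∀ h h' : Fin m, h ≤ h' → r h' ≤ r h := by
  intro h h' hhh
  obtain ⟨d, hd⟩ : ∃ d : ℕ, (h' : ℕ) = h + d := ⟨h' - h, by rw [Fin.le_def] at hhh; omega⟩
  induction d generalizing h' with
  | zero => rw [Nat.add_zero] at hd; rw [Fin.ext hd]
  | succ d ih =>
    have hlt : (h : ℕ) + d < m := by omega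
    set h'' : Fin m := ⟨h + d, hlt⟩ with hh''
    have h1 : r h'' ≤ r h := ih h'' (by rw [Fin.le_def]; simp [hh'']) (by simp [hh''])
    have h2 : (r h' : ℝ) ≤ ω * r h'' := hr h'' h' (by simp [hh'']; omega)
    have h3 : (r h' : ℝ) ≤ r h'' := by
      have : (0 : ℝ) ≤ r h'' := Nat.cast_nonneg _
      nlinarith
    have h4 : (r h' : ℝ) ≤ r h := h3.trans (by exact_mod_cast h1)
    exact_mod_cast h4

/-- **Roth's Lemma 10A, top half of the inductive step** (Schmidt, pp. 132–133). Let
`P ∈ ℤ[X₀,…,X_{n+1}]` (`m = n + 2` variables, `X_{n+1}` being Schmidt's `X_m`), `0 < ε < 1/12`,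
`ω = ω(m, ε)`, weights `r_h ≥ 1` with `r_{h+1} ≤ ω r_h` (10.3), a point `a`, an integer
`1 ≤ k ≤ r_m + 1`, multi-indices `μ₀,…,μ_{k-1}` not involving `X_m` with `|μ_i| ≤ i` (the
operators `Δ'_i` of (10.9)), the generalized Wronskian `W = det (P_{μ_i + j e_m})_{i,j<k}`, and a
factorisation `W = V U` with `V` free of `X_m` and `U` involving `X_m` only. If `V` has index
`≤ kε²/12` at `a` w.r.t. `r` (a witness `V_i(a) ≠ 0`, `i` free of `X_m`, `Σ i_h/r_h ≤ kε²/12`) and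
`U` has index `≤ kε²/12` (a witness `U_{ν e_m}(a) ≠ 0` with `ν/r_m ≤ kε²/12`) — Lemma 10B's
conclusion `Θ ≤ kε²/6` — then `P` has index `≤ ε` at `a` w.r.t. `r`: some `P_i(a) ≠ 0` with
`Σ i_h/r_h ≤ ε`. This version allows an integer scalar: `c W = V U` (so that `V`, `U` may be taken
to be integer slices of `W`, whose heights are at most `|W|`; `c ≠ 0` is then automatic).
[cite: Schmidt1980, Ch. V Thm 10A (completion of the proof, pp. 132–133)] -/
theorem rothLemma_of_wronskianData' {n : ℕ} (ε : ℝ) (hε0 : 0 < ε) (hε12 : ε < 1 / 12)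
    (r : Fin (n + 2) → ℕ) (hr0 : ∀ h, 0 < r h)
    (hr : ∀ h h' : Fin (n + 2), (h : ℕ) + 1 = h' → (r h' : ℝ) ≤ omega (n + 2) ε * r h)
    (a : Fin (n + 2) → ℝ) (P : MvPolynomial (Fin (n + 2)) ℤ)
    (k : ℕ) (hk : 0 < k) (hkr : k ≤ r (Fin.last (n + 1)) + 1)
    (μ : Fin k → (Fin (n + 2) →₀ ℕ)) (hμlast : ∀ i, μ i (Fin.last (n + 1)) = 0)
    (hμdeg : ∀ i, ∑ h, μ i h ≤ (i : ℕ))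
    (V U : MvPolynomial (Fin (n + 2)) ℤ) (c : ℤ)
    (hW : C c * (Matrix.of fun i j : Fin k =>
        hasseD (μ i + Finsupp.single (Fin.last (n + 1)) (j : ℕ)) P).det = V * U)
    (hVdeg : V.degreeOf (Fin.last (n + 1)) = 0)
    (hUdeg : ∀ h, h ≠ Fin.last (n + 1) → U.degreeOf h = 0)
    (hVwit : ∃ i : Fin (n + 2) →₀ ℕ, i (Fin.last (n + 1)) = 0 ∧ wt r i ≤ k * ε ^ 2 / 12 ∧
        aeval a (hasseD i V) ≠ 0)
    (hUwit : ∃ ν : ℕ, (ν : ℝ) / r (Fin.last (n + 1)) ≤ k * ε ^ 2 / 12 ∧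
        aeval a (hasseD (Finsupp.single (Fin.last (n + 1)) ν) U) ≠ 0) :
    ∃ i : Fin (n + 2) →₀ ℕ, wt r i ≤ ε ∧ aeval a (hasseD i P) ≠ 0 := by
  classical
  set L := Fin.last (n + 1) with hL
  set ω := omega (n + 2) ε with hω
  set M : Matrix (Fin k) (Fin k) (MvPolynomial (Fin (n + 2)) ℤ) :=
    Matrix.of fun i j : Fin k => hasseD (μ i + Finsupp.single L (j : ℕ)) P with hM
  have hkR : (0 : ℝ) < k := by exact_mod_cast hk
  have hrL : (0 : ℝ) < r L := by exact_mod_cast hr0 L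
  -- `ω ≤ ε²/24 < 1`
  have hωle : ω ≤ ε ^ 2 / 24 := omega_le_sq_div (n + 2) (by omega) hε0.le (by linarith)
  have hω1 : ω ≤ 1 := by nlinarith
  have hω0 : 0 < ω := omega_pos hε0
  -- Step 1: the index of `W` is `≤ kε²/6`
  obtain ⟨iV, hiVL, hiVwt, hiV⟩ := hVwit
  obtain ⟨ν, hνwt, hν⟩ := hUwit
  set iW := iV + Finsupp.single L ν with hiW
  have hWwit : aeval a (hasseD iW M.det) ≠ 0 := by
    have h1 : aeval a (hasseD iW (C c * M.det)) ≠ 0 := by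
      rw [hW, hiW, aeval_hasseD_mul_of_disjoint hVdeg hUdeg a hiVL ν]
      exact mul_ne_zero hiV hν
    rw [hasseD_C_mul, map_mul] at h1
    exact right_ne_zero_of_mul h1
  have hiWwt : wt r iW ≤ k * ε ^ 2 / 6 := by
    rw [hiW, wt_add]
    have : wt r (Finsupp.single L ν) = (ν : ℝ) / r L := by
      rw [wt, Finset.sum_eq_single L]
      · simp
      · intro h _ hh; simp [Ne.symm hh]
      · simp
    rw [this]; linarith
  -- Step 2: suppose the conclusion fails; then the index of `P` exceeds `ε`
  by_contra hcon
  push Not at hcon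
  obtain ⟨θ, hθε, hθ⟩ := exists_indexGe_gt P a r ε (fun i hi => by
    by_contra h; exact absurd (hcon i hi) (by simpa using h))
  have hθ0 : 0 ≤ θ := by linarith
  -- Step 3: the index of `W` is `≥ Σ_j max(θ - ω - j/r_m, 0)` (Lemma 6A, (10.9), (10.3))
  have hanti := antitone_of_succ_le hω1 r hr
  have hμwt : ∀ i, wt r (μ i) ≤ ω := by
    intro i
    -- `Σ_h μ_ih / r_h ≤ (Σ_h μ_ih)/r_{m-1} ≤ i/r_{m-1} ≤ (k-1)/r_{m-1} ≤ r_m/r_{m-1} ≤ ω`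
    set L' : Fin (n + 2) := ⟨n, by omega⟩ with hL'
    have hrL' : (0 : ℝ) < r L' := by exact_mod_cast hr0 L'
    have h1 : wt r (μ i) ≤ (∑ h, (μ i h : ℝ)) / r L' := by
      rw [wt, Finset.sum_div]
      apply Finset.sum_le_sum
      intro h _
      by_cases hhL : h = L
      · rw [hhL, hμlast i]; simp
      · have hle : h ≤ L' := by
          rw [Fin.le_def, hL']
          have := h.isLt
          have : (h : ℕ) ≠ n + 1 := fun he => hhL (Fin.ext (by rw [he]; rfl))
          simp only
          omega
        have : (r L' : ℝ) ≤ r h := by exact_mod_cast hanti h L' hle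
        apply div_le_div_of_nonneg_left (Nat.cast_nonneg _) hrL' this
    have h2 : (∑ h, (μ i h : ℝ)) ≤ (k : ℝ) - 1 := by
      have : ((∑ h, μ i h : ℕ) : ℝ) ≤ (i : ℕ) := by exact_mod_cast hμdeg i
      push_cast at this
      have hik : ((i : ℕ) : ℝ) + 1 ≤ k := by exact_mod_cast i.isLt
      linarith
    have h3 : (k : ℝ) - 1 ≤ r L := by
      have : (k : ℝ) ≤ r L + 1 := by exact_mod_cast hkr
      linarith
    have h4 : (r L : ℝ) ≤ ω * r L' := hr L' L (by simp [hL', hL])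
    calc wt r (μ i) ≤ (∑ h, (μ i h : ℝ)) / r L' := h1
      _ ≤ (r L : ℝ) / r L' := div_le_div_of_nonneg_right (h2.trans h3) hrL'.le
      _ ≤ ω := by rw [div_le_iff₀ hrL']; exact h4
  set c : Fin k → ℝ := fun j => θ - ω - (j : ℕ) / r L with hc
  have hMind : ∀ i j, IndexGe (M i j) a r (c j) := by
    intro i j
    simp only [hM, Matrix.of_apply, hc]
    have := hθ.hasseD (μ i + Finsupp.single L (j : ℕ))
    refine this.mono ?_
    rw [wt_add]
    have : wt r (Finsupp.single L (j : ℕ)) = ((j : ℕ) : ℝ) / r L := by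
      rw [wt, Finset.sum_eq_single L]
      · simp
      · intro h _ hh; simp [Ne.symm hh]
      · simp
    rw [this]
    linarith [hμwt i]
  have hWind : IndexGe M.det a r (∑ j, max (c j) 0) := indexGe_det_of_columns M a r c hMind
  -- Step 4: compare: `Σ_j max(θ - ω - j/r_m, 0) ≤ kε²/6`
  have hΘ : ∑ j : Fin k, max (c j) 0 ≤ k * ε ^ 2 / 6 := by
    by_contra hlt
    push Not at hlt
    exact hWwit (hWind iW (lt_of_le_of_lt hiWwt hlt))
  -- Step 5: (10.11) and Cases I/II
  have hsum : ∑ j ∈ Finset.range k, max (θ - j / r L) 0 < k * ε ^ 2 / 4 := by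
    have h1 : ∑ j ∈ Finset.range k, max (θ - j / r L) 0 ≤ ∑ j : Fin k, (max (c j) 0 + ω) := by
      rw [← Fin.sum_univ_eq_sum_range]
      apply Finset.sum_le_sum
      intro j _
      simp only [hc]
      rcases le_or_gt 0 (θ - ω - (j : ℕ) / r L) with h | h
      · rw [max_eq_left h, max_eq_left (by linarith)]; linarith
      · rw [max_eq_right h.le, zero_add]
        exact max_le (by linarith) hω0.le
    have h2 : ∑ j : Fin k, (max (c j) 0 + ω) = (∑ j : Fin k, max (c j) 0) + k * ω := by
      rw [Finset.sum_add_distrib, Finset.sum_const, Finset.card_univ, Fintype.card_fin, nsmul_eq_mul]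
    rw [h2] at h1
    have h3 : (k : ℝ) * ω ≤ k * (ε ^ 2 / 24) := mul_le_mul_of_nonneg_left hωle hkR.le
    nlinarith
  have hθlt : θ < ε :=
    lt_of_sum_max_sub_lt hk hkr (hr0 L) hε0 (by linarith) hθ0 hsum
  linarith

/-- **Roth's Lemma 10A, top half of the inductive step**, the case of an exact factorisation
`W = V U` (see `rothLemma_of_wronskianData'`).
[cite: Schmidt1980, Ch. V Thm 10A (completion of the proof, pp. 132–133)] -/
theorem rothLemma_of_wronskianData {n : ℕ} (ε : ℝ) (hε0 : 0 < ε) (hε12 : ε < 1 / 12)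
    (r : Fin (n + 2) → ℕ) (hr0 : ∀ h, 0 < r h)
    (hr : ∀ h h' : Fin (n + 2), (h : ℕ) + 1 = h' → (r h' : ℝ) ≤ omega (n + 2) ε * r h)
    (a : Fin (n + 2) → ℝ) (P : MvPolynomial (Fin (n + 2)) ℤ)
    (k : ℕ) (hk : 0 < k) (hkr : k ≤ r (Fin.last (n + 1)) + 1)
    (μ : Fin k → (Fin (n + 2) →₀ ℕ)) (hμlast : ∀ i, μ i (Fin.last (n + 1)) = 0)
    (hμdeg : ∀ i, ∑ h, μ i h ≤ (i : ℕ))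
    (V U : MvPolynomial (Fin (n + 2)) ℤ)
    (hW : (Matrix.of fun i j : Fin k =>
        hasseD (μ i + Finsupp.single (Fin.last (n + 1)) (j : ℕ)) P).det = V * U)
    (hVdeg : V.degreeOf (Fin.last (n + 1)) = 0)
    (hUdeg : ∀ h, h ≠ Fin.last (n + 1) → U.degreeOf h = 0)
    (hVwit : ∃ i : Fin (n + 2) →₀ ℕ, i (Fin.last (n + 1)) = 0 ∧ wt r i ≤ k * ε ^ 2 / 12 ∧
        aeval a (hasseD i V) ≠ 0)
    (hUwit : ∃ ν : ℕ, (ν : ℝ) / r (Fin.last (n + 1)) ≤ k * ε ^ 2 / 12 ∧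
        aeval a (hasseD (Finsupp.single (Fin.last (n + 1)) ν) U) ≠ 0) :
    ∃ i : Fin (n + 2) →₀ ℕ, wt r i ≤ ε ∧ aeval a (hasseD i P) ≠ 0 :=
  rothLemma_of_wronskianData' ε hε0 hε12 r hr0 hr a P k hk hkr μ hμlast hμdeg V U 1
    (by rw [map_one, one_mul]; exact hW) hVdeg hUdeg hVwit hUwit

end Roth

end Literature.NumberTheory.DiophantineGeometry
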